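/-
Copyright (c) 2026. All rights reserved.
Released under Apache 2.0 license as described in the file LICENSE.
-/
import Literature.AlgebraicGeometry.CossartPiltant200819.GaloisApproximation2008
import Literature.AlgebraicGeometry.CossartPiltant200819.RamificationDescent2008
import HarnessLib

/-!
# Cossart–Piltant 2008, Proposition 6.2 (2): `κ(Rʳ) = κ(Rⁱ)` (27) and the averaging (29)–(30)

[CossartPiltant2008] Prop. 6.2 (Galois approximation), HAL hal-00139124 p. 17 (journal
J. Algebra 320 (2008), Prop. 6.2), VERBATIM: "Let `L/K` be a Galois extension of function fields
over `k` and let `W/k` be a `k`-valuation ring such that `QF(W) = L`. Let `V := W ∩ K`. For any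
given normal local model `R` of `V/k`, let `R̃` be the unique normal local model of `W/k` which
lies above `R`, and let `Rˢ` (resp. `Rⁱ`) be the splitting ring (resp. inertia ring) of `R̃` over
`R`. There exists a normal local model `R₀` of `V/k` such that for any normal local model `R` of
`V/k` dominating `R₀`, the following holds.
(1) We have `G_s(W/V) = G_s(R̃/R)` and `G_i(W/V) = G_i(R̃/R)` (26), i.e. `Rˢ = R̃^{G_s(W/V)}` and
`Rⁱ = R̃^{G_i(W/V)}`.
(2) Let `Rʳ := R̃^{G_r(W/V)}`. Then `κ(Rʳ) = κ(Rⁱ)` (27), and the action of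
`H := G_i(W/V)/G_r(W/V)` on `Rʳ` is induced by a diagonal `κ(Rⁱ)`-linear action on
`R̂ʳ ≃ κ(Rⁱ)[[x₁, …, xₙ]]/I`."

Part (1) is `CP2008.galoisApproximation_holds` (`GaloisApproximation2008.lean`). This file treats
part (2), in the tree's dictionary (`LocalModels2008`, `GaloisSegment2008`): `R̃ = normalModelAbove
W R` (the fractions `b/t`, `b, t ∈ L` integral over `R ⊆ K`, `W(t) = 0`), `G_i(W/V) = inertiaGroup
W`, `G_r(W/V) = ramificationGroup W`, `Rʳ = R̃^{G_r(W/V)}` and `Rⁱ = R̃^{G_i(W/V)}` the sets of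
fixed points (the reading "i.e. `Rⁱ = R̃^{G_i(W/V)}`" of (26)), `m_W ∩ Rʳ = m_{Rʳ}` (HAL p. 18,
l. 31: "`g.η − η ∈ m_W ∩ Rʳ = m_{Rʳ}`"; `Rʳ` is dominated by `W`:
`inv_mem_normalModelAbove_of_valuation_eq_one`), so that `κ(Rʳ)` and `κ(Rⁱ)` are subfields of
`κ(W)` and (27) says that they coincide there. (Line numbers "l." count the lines of the text
layer of the HAL page, running head included, as materialised by `lit read`.)

* `exists_mem_fixedPoints_inertiaGroup_sub_lt` — **(27), PROVED**: for `L/K` finite, `k ⊆ W`, and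
  ANY `k`-subalgebra `R ⊆ V` (in particular every normal local model of `V`, with no condition
  `R₀ < R`): every `η ∈ Rʳ` is congruent modulo `m_W` to some `θ ∈ Rⁱ`;
  `residue_image_fixedPoints_eq` — the same as the equality of the images of `Rʳ` and `Rⁱ` in
  `κ(W)`, i.e. "`κ(Rʳ) = κ(Rⁱ)`" read inside `κ(W)`.
  ROUTE (a reproduction of the printed STATEMENT (27) along a DIFFERENT, shorter argument — the
  one the printed proof itself uses at (29)): put `θ := |H|⁻¹ Σ_{h ∈ H} h.η`, the average of `η`
  over `H = G_i/G_r` (well defined since `G_r` fixes `η`; `|H| = (G_i : G_r)` is prime to the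
  residue characteristic by (8)/Zariski–Samuel VI §12 (23), `not_dvd_relIndex_ramificationGroup`,
  hence a unit of `k ⊆ R`): `θ ∈ R̃` because `G_i ⊆ G_s` stabilises `R̃`
  (`image_normalModelAbove_subset`) and `R̃` is a ring (`add_mem_normalModelAbove`,
  `mul_mem_normalModelAbove`); `θ` is `G_i`-invariant (reindex the cosets); and
  `η − θ = |H|⁻¹ Σ_h (η − h.η) ∈ m_W` since each `h.η − η ∈ m_W` by the definition of `G_i`
  (HAL p. 5 (3), `mem_inertiaGroup_iff'`). The printed proof of (27) (HAL p. 18, l. 16–38: minimal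
  polynomial of `η` over `Kⁱ`, `P̄ = (X − η̄)^{deg P}`, `deg P` prime to `p`, and `κ(R̃)/κ(Rⁱ)`
  purely inseparable by [4] = Abhyankar 1959, Thm 1.48) is NOT followed: the model-level inertia
  theory of [4] (Prop 1.46, Thm 1.48) is not in the tree. Nothing printed is contradicted or
  weakened: (27) is obtained for every `R`, the printed hypothesis `R₀ < R` being used in print for
  (26) and for (28)–(30) only.
* `apply_twistedAverage_eq_smul`, `map_twistedAverage_eq` — **the algebra of (29)–(30), PROVED**
  abstractly: for a finite group `H` acting `κ`-linearly on `M` (`ρ : H →* End_κ M`), a character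
  `χ : H →* κ` and `x ∈ M`, the twisted average `y := |H|⁻¹ Σ_{h∈H} χ(h⁻¹) h.x` (29) satisfies
  `h.y = χ(h) y` (30), and `f(y) = f(x)` for every `κ`-linear `H`-map `f` with
  `f(h.x) = χ(h) f(x)` and `|H| ≠ 0` in `κ` ("It is immediately checked that `ȳ_j = x̄_j` and that
  `h.y_j = χ_j(h) y_j`", HAL p. 19 l. 13, with `f` the initial-form map `m_{R̂ʳ} → m_{Rʳ}/m²_{Rʳ}`).
* NOT typed here (it needs the completion `R̂ʳ`, a coefficient field `κ(Rⁱ) ⊂ R̂ⁱ`, the extension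
  of the `H`-action to `R̂ʳ` and `μ_ε ⊆ κ(Rⁱ)` "after possibly changing `R₀`", none of which has a
  tree dictionary): the second clause of (2) itself — (28) "`ρ : H → GL(m_{Rʳ}/m²_{Rʳ})` … is
  diagonal up to choosing a basis" and "`R̂ʳ ≃ κ(Rⁱ)[[x₁,…,xₙ]]/I`" with (30) on `R̂ʳ`. Its
  consumer in the paper is the proof of Lemma 9.4 (HAL p. 30), typed in `TameDescent2008.lean` as
  the named statement `TamePrimeDescentViaStableModel`, which is unaffected.

Supporting [folklore] lemmas: `isIntegralOverSub_iff_isIntegral` (the tree's `IsIntegralOverSub R`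
is Mathlib's `IsIntegral ↥R` for the algebra structure `↥R → K → L`), closure of `R̃` under
`0, 1, +, ·, Σ`, under `K ∋ a ∈ R ↦ a` and under inverses of elements of value `0`
(`R̃` is dominated by `W`), and `natCast_relIndex_ramificationGroup_ne_zero` (`|G_i/G_r| ≠ 0` in
`L`, from `RamificationDescent2008.not_dvd_relIndex_ramificationGroup`).

AI-written reading aid; nothing here has been reviewed by the authors or by an expert.

## Sources
- [CossartPiltant2008] V. Cossart, O. Piltant, Resolution of singularities of threefolds in
  positive characteristic I, J. Algebra 320 (2008) 1051–1082; HAL hal-00139124v1: Prop 6.2 and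
  its proof (HAL p. 17–19, (26)–(30)), §3.2 (8) (p. 6), §3 (3) (p. 5).
- [ZariskiSamuel1960] O. Zariski, P. Samuel, Commutative Algebra II, Van Nostrand 1960,
  Ch. VI §12 ((23), Thm 24).
- [4] of the paper = S. Abhyankar, Ramification theoretic methods in algebraic geometry, Annals
  of Math. Studies 43, Princeton 1959 (Prop 1.46, Thm 1.48) — cited in print, not used here.
-/

noncomputable section

namespace Literature.AlgebraicGeometry.CossartPiltant200819.CP2008

open Literature.AlgebraicGeometry.Resolution IsLocalRing Polynomial
open scoped Pointwise

universe u

/-! ### `IsIntegralOverSub` is `IsIntegral`, and `R̃` is a ring dominated by `W` -/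

section OverSub

variable {k K L : Type u} [Field k] [Field K] [Algebra k K] [Field L] [Algebra K L]

/-- The tree's "integral over the subring `R ⊆ K`" (a monic equation with coefficients in `R`,
written in `K[X]`) is Mathlib's `IsIntegral ↥R` for `↥R → K → L`. [folklore] -/
theorem isIntegralOverSub_iff_isIntegral (R : Subalgebra k K) (b : L) :
    IsIntegralOverSub R b ↔ IsIntegral R b := by
  constructor
  · rintro ⟨q, hqm, hqc, hqb⟩
    have hlifts : q ∈ Polynomial.lifts (algebraMap R K) :=
      (Polynomial.lifts_iff_coeff_lifts q).mpr fun i => ⟨⟨q.coeff i, hqc i⟩, rfl⟩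
    obtain ⟨p, hpq, -, hpm⟩ := Polynomial.lifts_and_degree_eq_and_monic hlifts hqm
    refine ⟨p, hpm, ?_⟩
    have h0 : aeval b q = 0 := hqb
    rw [← hpq, Polynomial.aeval_map_algebraMap, Polynomial.aeval_def] at h0
    exact h0
  · rintro ⟨p, hpm, hpb⟩
    refine ⟨p.map (algebraMap R K), hpm.map _, fun i => ?_, ?_⟩
    · rw [Polynomial.coeff_map]
      exact (p.coeff i).2
    · rw [Polynomial.aeval_map_algebraMap, Polynomial.aeval_def]
      exact hpb

/-- Sums of `R`-integral elements are `R`-integral. [folklore] -/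
theorem IsIntegralOverSub.add {R : Subalgebra k K} {b c : L} (hb : IsIntegralOverSub R b)
    (hc : IsIntegralOverSub R c) : IsIntegralOverSub R (b + c) := by
  rw [isIntegralOverSub_iff_isIntegral] at hb hc ⊢
  exact hb.add hc

/-- Products of `R`-integral elements are `R`-integral. [folklore] -/
theorem IsIntegralOverSub.mul {R : Subalgebra k K} {b c : L} (hb : IsIntegralOverSub R b)
    (hc : IsIntegralOverSub R c) : IsIntegralOverSub R (b * c) := by
  rw [isIntegralOverSub_iff_isIntegral] at hb hc ⊢
  exact hb.mul hc

/-- Elements of `R` are `R`-integral (`X − a`). [folklore] -/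
theorem isIntegralOverSub_algebraMap {R : Subalgebra k K} {a : K} (ha : a ∈ R) :
    IsIntegralOverSub (L := L) R (algebraMap K L a) := by
  rw [isIntegralOverSub_iff_isIntegral]
  have h : algebraMap K L a = algebraMap R L ⟨a, ha⟩ := rfl
  rw [h]
  exact isIntegral_algebraMap

/-- `0 ∈ R̃`. [folklore] -/
theorem zero_mem_normalModelAbove (W : ValuationSubring L) (R : Subalgebra k K) :
    (0 : L) ∈ normalModelAbove W R := by
  have h := isIntegralOverSub_algebraMap (L := L) R.zero_mem
  rw [map_zero] at h
  exact mem_normalModelAbove_of_isIntegralOverSub W h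

/-- `a ∈ R ⇒ a ∈ R̃` (`R ⊆ R̃`). [folklore] -/
theorem algebraMap_mem_normalModelAbove (W : ValuationSubring L) {R : Subalgebra k K} {a : K}
    (ha : a ∈ R) : algebraMap K L a ∈ normalModelAbove W R :=
  mem_normalModelAbove_of_isIntegralOverSub W (isIntegralOverSub_algebraMap ha)

/-- **`R̃` is closed under addition**: `b/t + c/u = (bu + ct)/(tu)`. [folklore] -/
theorem add_mem_normalModelAbove (W : ValuationSubring L) {R : Subalgebra k K} {x y : L}
    (hx : x ∈ normalModelAbove W R) (hy : y ∈ normalModelAbove W R) :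
    x + y ∈ normalModelAbove W R := by
  obtain ⟨b, t, hb, ht, hvt, rfl⟩ := hx
  obtain ⟨c, u, hc, hu, hvu, rfl⟩ := hy
  have ht0 : t ≠ 0 := ne_zero_of_valuation_eq_one W hvt
  have hu0 : u ≠ 0 := ne_zero_of_valuation_eq_one W hvu
  refine ⟨b * u + c * t, t * u, (hb.mul hu).add (hc.mul ht), ht.mul hu,
    by rw [map_mul, hvt, hvu, mul_one], ?_⟩
  field_simp

/-- **`R̃` is closed under multiplication**: `(b/t)(c/u) = (bc)/(tu)`. [folklore] -/
theorem mul_mem_normalModelAbove (W : ValuationSubring L) {R : Subalgebra k K} {x y : L}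
    (hx : x ∈ normalModelAbove W R) (hy : y ∈ normalModelAbove W R) :
    x * y ∈ normalModelAbove W R := by
  obtain ⟨b, t, hb, ht, hvt, rfl⟩ := hx
  obtain ⟨c, u, hc, hu, hvu, rfl⟩ := hy
  refine ⟨b * c, t * u, hb.mul hc, ht.mul hu, by rw [map_mul, hvt, hvu, mul_one], ?_⟩
  rw [mul_inv]
  ring

/-- `R̃` is closed under finite sums. [folklore] -/
theorem sum_mem_normalModelAbove (W : ValuationSubring L) {R : Subalgebra k K} {ι : Type*}
    (s : Finset ι) {f : ι → L} (hf : ∀ i ∈ s, f i ∈ normalModelAbove W R) :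
    (∑ i ∈ s, f i) ∈ normalModelAbove W R :=
  Finset.sum_induction f (· ∈ normalModelAbove W R) (fun _ _ ha hb => add_mem_normalModelAbove W ha hb)
    (zero_mem_normalModelAbove W R) hf

/-- **`R̃` is dominated by `W`**: an element of `R̃` of value `0` is a unit of `R̃`
(`(b/t)⁻¹ = t/b`, `W(b) = W(t) = 0`); whence `m_W ∩ R̃ = m_{R̃}` and, for the rings of invariants,
"`m_W ∩ Rʳ = m_{Rʳ}`" (HAL p. 18, l. 31). [cite: CossartPiltant2008, Prop 6.2, proof (HAL p. 18 l. 31)] -/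
theorem inv_mem_normalModelAbove_of_valuation_eq_one (W : ValuationSubring L)
    {R : Subalgebra k K} {x : L} (hx : x ∈ normalModelAbove W R) (hvx : W.valuation x = 1) :
    x⁻¹ ∈ normalModelAbove W R := by
  obtain ⟨b, t, hb, ht, hvt, rfl⟩ := hx
  have hvb : W.valuation b = 1 := by
    have h := hvx
    rw [map_mul, map_inv₀, hvt, inv_one, mul_one] at h
    exact h
  refine ⟨t, b, ht, hb, hvb, ?_⟩
  rw [mul_inv, inv_inv, mul_comm]

/-- `g.W = W ⇒ g.x ∈ R̃` for `x ∈ R̃` (elementwise form of `image_normalModelAbove_subset`).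
[folklore] -/
theorem map_mem_normalModelAbove (W : ValuationSubring L) {R : Subalgebra k K}
    {σ : L ≃ₐ[K] L} (hσ : σ • W = W) {x : L} (hx : x ∈ normalModelAbove W R) :
    σ x ∈ normalModelAbove W R :=
  image_normalModelAbove_subset W hσ ⟨x, hx, rfl⟩

end OverSub

/-! ### (27): `κ(Rʳ) = κ(Rⁱ)` -/

section Residue

variable {k K L : Type u} [Field k] [Field K] [Algebra k K] [Field L] [Algebra K L]
  [Algebra k L]

omit [Algebra k K] in
/-- **`|H| = (G_i : G_r)` is invertible in `L`** (`k ⊆ W`): the order of `H = G_i(W/V)/G_r(W/V)`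
is prime to the residue characteristic — HAL p. 18 l. 20–21 (proof of Prop. 6.2): "By (8),
`Kʳ/Kⁱ` is an Abelian extension of degree prime to `p` with group `H`", where (8) is the
isomorphism `G_i(W_j/V)/G_r(W_j/V) ≃ Hom(W_jL/VK, κ(W_j)^×)` of HAL p. 6 l. 27 (Zariski–Samuel VI
§12 (23)); and `char κ(W) = char k = char L`. (The same sentence recurs at HAL p. 20 l. 44 for
`K₀ʳ/K₀ⁱ`, in the proof of Thm. 7.2.)
[cite: CossartPiltant2008, Prop 6.2, proof (HAL p. 18 l. 20–21); §3.2 (8) (HAL p. 6 l. 27)] -/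
theorem natCast_relIndex_ramificationGroup_ne_zero [FiniteDimensional K L]
    (W : ValuationSubring L) (hk : ∀ c : k, algebraMap k L c ∈ W) :
    (((ramificationGroup (K := K) W).relIndex (inertiaGroup W) : ℕ) : L) ≠ 0 := by
  have hfin : (ramificationGroup (K := K) W).relIndex (inertiaGroup W) ≠ 0 := by
    rw [Subgroup.relIndex]
    exact Subgroup.FiniteIndex.index_ne_zero
  rcases CharP.exists' L with hL | ⟨p, hp, hLp⟩
  · haveI := hL
    exact Nat.cast_ne_zero.mpr hfin
  · haveI := hp
    haveI : CharP k p := (RingHom.charP_iff_charP (algebraMap k L) p).mpr hLp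
    haveI : CharP (ResidueField W) p := charP_residueField p W hk
    intro h0
    exact not_dvd_relIndex_ramificationGroup (K := K) W ((CharP.cast_eq_zero_iff L p _).mp h0)

/-- **Cossart–Piltant 2008, Prop 6.2 (2), (27) `κ(Rʳ) = κ(Rⁱ)` — PROVED, elementwise**: for `L/K`
finite, `W` a valuation ring of `L` containing `k`, `R ⊆ V = W ∩ K` any `k`-subalgebra (e.g. a
normal local model of `V`), `R̃ = normalModelAbove W R`, every `η ∈ Rʳ = R̃^{G_r(W/V)}` is
congruent modulo `m_W` (`W(η − θ) > 0`) to some `θ ∈ Rⁱ = R̃^{G_i(W/V)}`. Proof by averaging over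
`H = G_i/G_r` (module docstring; the device of (29)), not by the printed minimal-polynomial
argument. [cite: CossartPiltant2008, Prop 6.2 (2), (27) (HAL p. 17 l. 58–59; proof p. 18 l. 16–38)] -/
theorem exists_mem_fixedPoints_inertiaGroup_sub_lt [FiniteDimensional K L]
    (W : ValuationSubring L) (hk : ∀ c : k, algebraMap k L c ∈ W) (R : Subalgebra k K)
    (hRW : ∀ a ∈ R, algebraMap K L a ∈ W) {η : L} (hη : η ∈ normalModelAbove W R)
    (hfix : ∀ σ ∈ ramificationGroup (K := K) W, σ η = η) :
    ∃ θ ∈ normalModelAbove W R,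
      (∀ σ ∈ inertiaGroup (K := K) W, σ θ = θ) ∧ W.valuation (η - θ) < 1 := by
  classical
  set Gi : Subgroup (L ≃ₐ[K] L) := inertiaGroup (K := K) W with hGi
  set H : Subgroup Gi := (ramificationGroup (K := K) W).subgroupOf Gi with hH
  haveI : Fintype (Gi ⧸ H) := Fintype.ofFinite _
  obtain ⟨m, hm⟩ : ∃ m : ℕ, Fintype.card (Gi ⧸ H) = m := ⟨_, rfl⟩
  have hm0 : (m : L) ≠ 0 := by
    have h := natCast_relIndex_ramificationGroup_ne_zero (K := K) W hk
    rwa [Subgroup.relIndex, Subgroup.index_eq_card, Nat.card_eq_fintype_card, hm] at h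
  have hηW : η ∈ W := normalModelAbove_subset W hRW hη
  -- each coset representative stabilises `W`, hence `R̃`, and moves `η` within `η + m_W`
  have hstab : ∀ q : Gi ⧸ H, ((q.out : Gi) : L ≃ₐ[K] L) • W = W := fun q =>
    ((mem_inertiaGroup_iff' W _).mp (q.out).2).1
  have hnear : ∀ q : Gi ⧸ H, W.valuation (η - ((q.out : Gi) : L ≃ₐ[K] L) η) < 1 := fun q => by
    rw [Valuation.map_sub_swap]
    exact ((mem_inertiaGroup_iff' W _).mp (q.out).2).2 η hηW
  -- reindexing the cosets by `σ ∈ G_i`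
  have hterm : ∀ (σ : L ≃ₐ[K] L) (hσ : σ ∈ Gi) (q : Gi ⧸ H),
      σ (((q.out : Gi) : L ≃ₐ[K] L) η) =
        ((((⟨σ, hσ⟩ : Gi) • q).out : Gi) : L ≃ₐ[K] L) η := by
    intro σ hσ q
    have hab : ((⟨σ, hσ⟩ : Gi) * q.out)⁻¹ * ((⟨σ, hσ⟩ : Gi) • q).out ∈ H := by
      rw [← QuotientGroup.eq, QuotientGroup.out_eq', ← MulAction.Quotient.coe_smul_out,
        smul_eq_mul]
    have hfixab := hfix _ (Subgroup.mem_subgroupOf.mp hab)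
    rw [Subgroup.coe_mul, Subgroup.coe_inv, AlgEquiv.mul_apply] at hfixab
    have key := congrArg ((((⟨σ, hσ⟩ : Gi) * q.out : Gi)) : L ≃ₐ[K] L) hfixab
    rw [← AlgEquiv.mul_apply, mul_inv_cancel, AlgEquiv.one_apply] at key
    rw [key, Subgroup.coe_mul, AlgEquiv.mul_apply]
  refine ⟨(m : L)⁻¹ * ∑ q : Gi ⧸ H, ((q.out : Gi) : L ≃ₐ[K] L) η, ?_, ?_, ?_⟩
  · -- `θ ∈ R̃`
    have hminv : ((m : L))⁻¹ ∈ normalModelAbove W R := by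
      have h1 : ((m : L))⁻¹ = algebraMap K L (algebraMap k K ((m : k)⁻¹)) := by
        rw [map_inv₀, map_natCast, map_inv₀, map_natCast]
      rw [h1]
      exact algebraMap_mem_normalModelAbove W (R.algebraMap_mem _)
    exact mul_mem_normalModelAbove W hminv
      (sum_mem_normalModelAbove W _ fun q _ => map_mem_normalModelAbove W (hstab q) hη)
  · -- `θ` is `G_i`-invariant
    intro σ hσ
    rw [map_mul, map_inv₀, map_natCast, map_sum]
    congr 1
    exact Fintype.sum_equiv (MulAction.toPerm (⟨σ, hσ⟩ : Gi)) _ _ fun q => by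
      rw [MulAction.toPerm_apply]
      exact hterm σ hσ q
  · -- `η − θ ∈ m_W`
    have hsplit : η - (m : L)⁻¹ * ∑ q : Gi ⧸ H, ((q.out : Gi) : L ≃ₐ[K] L) η =
        (m : L)⁻¹ * ∑ q : Gi ⧸ H, (η - ((q.out : Gi) : L ≃ₐ[K] L) η) := by
      rw [Finset.sum_sub_distrib, Finset.sum_const, Finset.card_univ, hm, nsmul_eq_mul, mul_sub,
        ← mul_assoc, inv_mul_cancel₀ hm0, one_mul]
    have hv1 : W.valuation ((m : L)⁻¹) ≤ 1 := by
      rw [W.valuation_le_one_iff]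
      have h1 : ((m : L))⁻¹ = algebraMap k L ((m : k)⁻¹) := by rw [map_inv₀, map_natCast]
      rw [h1]
      exact hk _
    have hvS : W.valuation (∑ q : Gi ⧸ H, (η - ((q.out : Gi) : L ≃ₐ[K] L) η)) < 1 :=
      W.valuation.map_sum_lt one_ne_zero fun q _ => hnear q
    rw [hsplit, map_mul]
    calc W.valuation ((m : L)⁻¹) * W.valuation (∑ q : Gi ⧸ H, (η - ((q.out : Gi) : L ≃ₐ[K] L) η))
        ≤ 1 * W.valuation (∑ q : Gi ⧸ H, (η - ((q.out : Gi) : L ≃ₐ[K] L) η)) :=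
          mul_le_mul' hv1 le_rfl
      _ < 1 := by rw [one_mul]; exact hvS

/-- **(27) `κ(Rʳ) = κ(Rⁱ)` inside `κ(W)`** — PROVED: the images in `κ(W)` of
`Rʳ = R̃^{G_r(W/V)}` and of `Rⁱ = R̃^{G_i(W/V)}` coincide (`Rⁱ ⊆ Rʳ` as `G_r ≤ G_i`; the other
inclusion is `exists_mem_fixedPoints_inertiaGroup_sub_lt`). Since `m_W ∩ Rʳ = m_{Rʳ}` and
`m_W ∩ Rⁱ = m_{Rⁱ}` (`inv_mem_normalModelAbove_of_valuation_eq_one`), these images are `κ(Rʳ)`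
and `κ(Rⁱ)`. [cite: CossartPiltant2008, Prop 6.2 (2), (27) (HAL p. 17 l. 58–59)] -/
theorem residue_image_fixedPoints_eq [FiniteDimensional K L]
    (W : ValuationSubring L) (hk : ∀ c : k, algebraMap k L c ∈ W) (R : Subalgebra k K)
    (hRW : ∀ a ∈ R, algebraMap K L a ∈ W) :
    (IsLocalRing.residue W) '' {x : W | (x : L) ∈ normalModelAbove W R ∧
        ∀ σ ∈ ramificationGroup (K := K) W, σ x = x} =
      (IsLocalRing.residue W) '' {x : W | (x : L) ∈ normalModelAbove W R ∧
        ∀ σ ∈ inertiaGroup (K := K) W, σ x = x} := by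
  refine Set.Subset.antisymm ?_ ?_
  · rintro _ ⟨x, ⟨hxR, hxfix⟩, rfl⟩
    obtain ⟨θ, hθR, hθfix, hv⟩ :=
      exists_mem_fixedPoints_inertiaGroup_sub_lt (K := K) W hk R hRW hxR hxfix
    have hθW : θ ∈ W := normalModelAbove_subset W hRW hθR
    refine ⟨⟨θ, hθW⟩, ⟨hθR, hθfix⟩, ?_⟩
    rw [eq_comm, ← sub_eq_zero, ← map_sub, residue_eq_zero_iff, W.valuation_lt_one_iff]
    exact hv
  · rintro _ ⟨x, ⟨hxR, hxfix⟩, rfl⟩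
    exact ⟨x, ⟨hxR, fun σ hσ => hxfix σ (ramificationGroup_le_inertiaGroup W hσ)⟩, rfl⟩

end Residue

/-! ### (29)–(30): the twisted average over `H` -/

section Averaging

variable {κ : Type*} [Field κ] {H : Type*} [Group H] [Fintype H]
  {M N : Type*} [AddCommGroup M] [Module κ M] [AddCommGroup N] [Module κ N]

/-- **(30) for the un-normalised average**: for `ρ : H → End_κ(M)` a linear action, `χ : H → κ`
multiplicative and `x ∈ M`, `g.(Σ_h χ(h⁻¹) h.x) = χ(g) Σ_h χ(h⁻¹) h.x` (reindex `h ↦ gh`).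
[cite: CossartPiltant2008, Prop 6.2, proof, (29)–(30) (HAL p. 19 l. 3–19)] -/
theorem apply_sum_twisted_eq_smul (ρ : H →* Module.End κ M) (χ : H →* κ) (x : M) (g : H) :
    ρ g (∑ h, χ h⁻¹ • ρ h x) = χ g • ∑ h, χ h⁻¹ • ρ h x := by
  rw [map_sum, Finset.smul_sum]
  refine Fintype.sum_equiv (Equiv.mulLeft g) _ _ fun h => ?_
  simp only [Equiv.coe_mulLeft]
  rw [LinearMap.map_smul, ← Module.End.mul_apply, ← map_mul, smul_smul]
  congr 1
  rw [mul_inv_rev, map_mul, mul_left_comm, ← map_mul, mul_inv_cancel, map_one, mul_one]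

/-- **(29)–(30)**: "Let `y_j := |H|⁻¹ Σ_{h∈H} χ_j(h⁻¹)(h.x_j)` (29). It is immediately checked …
that `h.y_j = χ_j(h) y_j` for each `h ∈ H`" — for any linear `H`-action `ρ` on a `κ`-module, any
multiplicative `χ : H → κ` and any `x`. [cite: CossartPiltant2008, Prop 6.2, proof, (29)–(30) (HAL p. 19 l. 3–19)] -/
theorem apply_twistedAverage_eq_smul (ρ : H →* Module.End κ M) (χ : H →* κ) (x : M) (g : H) :
    ρ g ((Fintype.card H : κ)⁻¹ • ∑ h, χ h⁻¹ • ρ h x) =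
      χ g • ((Fintype.card H : κ)⁻¹ • ∑ h, χ h⁻¹ • ρ h x) := by
  rw [LinearMap.map_smul, apply_sum_twisted_eq_smul, smul_comm]

/-- **(29)**: "It is immediately checked that `ȳ_j = x̄_j`" — if `f` is `κ`-linear with
`f(h.x) = χ(h) f(x)` for all `h` (for (29): `f` = the initial form `m_{R̂ʳ} → m_{Rʳ}/m²_{Rʳ}`, on
which `h` acts on `x̄_j` by `χ_j(h)` by (28)) and `|H| ≠ 0` in `κ`, then `f(y) = f(x)` for the
twisted average `y = |H|⁻¹ Σ_h χ(h⁻¹) h.x`. [cite: CossartPiltant2008, Prop 6.2, proof, (29) (HAL p. 19 l. 3–13)] -/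
theorem map_twistedAverage_eq (ρ : H →* Module.End κ M) (χ : H →* κ) (x : M) (f : M →ₗ[κ] N)
    (hf : ∀ h, f (ρ h x) = χ h • f x) (hH : (Fintype.card H : κ) ≠ 0) :
    f ((Fintype.card H : κ)⁻¹ • ∑ h, χ h⁻¹ • ρ h x) = f x := by
  rw [LinearMap.map_smul, map_sum]
  simp_rw [LinearMap.map_smul, hf, smul_smul, ← map_mul, inv_mul_cancel, map_one, one_smul]
  rw [Finset.sum_const, Finset.card_univ, ← Nat.cast_smul_eq_nsmul κ, smul_smul,
    inv_mul_cancel₀ hH, one_smul]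

end Averaging

end Literature.AlgebraicGeometry.CossartPiltant200819.CP2008

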